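import Summits.QuantumAdvantage.QuantumAdvantage.Theorems.LinnikCubicClassGroupsDegreeOnePrimesEscapeClassPNTTheta
import Summits.QuantumAdvantage.QuantumAdvantage.Theorems.LinnikCubicClassGroupsDegreeOnePrimesEscapePerCharacterDeficitPartialSummation
import Literature.NumberTheory.LFunctions.UniformClassGroupPNTTransferMain
import HarnessLib

/-!
# The additive class prime number theorem, VI: partial summation — from `θ_C` to `π_C`

Topic `Summits/QuantumAdvantage/QuantumAdvantage/Theorems`, cell B2b-1 (linnik-cubic), PART A, the
`stub_classPNTAdditive` slice of the crux `DegreeOnePrimesEscape` (stmt-QuantumAdvantage-11543), in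
DEGREE-LOCAL form.  HONEST FRAMING: the value of this file is a THEOREM — not summit progress.

The transfer of the `θ_C`-dichotomy (`thetaClass_dichotomy`, file V) to the prime ideal counting functions
`π_C(x)` by partial summation `π_C(x) = θ_C(x)/log x + ∫₂ˣ θ_C(t) dt/(t log² t)`
(`primeIdealClassCount_eq_theta_div_log_add_integral`), with an ADDITIVE error: the main term
`g(t)/h = (t − θ₁ t^β/β)/h` is transferred exactly to `(Li(x) − θ₁ Li(x^β))/h` by the tree's
`abs_sub_exceptionalLiMain_le` (with `A = 0`), and the error `|θ_C − g/h| ≤ η t/h` (`t ≥ y`), `≤ B t` (`t ≤ y`)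
contributes at most `η (Li(x) + 3)/h + 3 B y` (`abs_transfer_error_le`); together, per class,
`abs_primeIdealClassCount_sub_main_le`.  Also: the exceptional zero of the family lies in
`(1 − 1/(8 log Q), 1)` (`excRegion_le_inv_eight_log_condQn`).  The final assembly is in file VII
(`…ClassPNTOfDensity.lean`).
-/

noncomputable section

open Complex Real MeasureTheory Set Filter Topology
open scoped NumberField nonZeroDivisors

namespace Summit.QuantumAdvantage.QuantumAdvantage.Theorems.DegreeOnePrimesEscape

open Literature.NumberTheory.LFunctions Literature.NumberTheory.LFunctions.NumberField
  Literature.NumberTheory.LFunctions.AbelianDensity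

/-! ### The error part of the transfer -/

/-- **Two-sided partial summation of an error term.**  If `E` is integrable against `dt/(t log² t)` on
`[2, x]`, `|E(t)| ≤ B t` on `[2, y]` and `|E(t)| ≤ e t` on `[y, x]` (`2 ≤ y ≤ x`, `B, e ≥ 0`), then
`|E(x)/log x + ∫₂ˣ E(t) dt/(t log² t)| ≤ e (Li(x) + 3) + 3 B y`. -/
theorem abs_transfer_error_le {E : ℝ → ℝ} {B e y x : ℝ} (hy : 2 ≤ y) (hyx : y ≤ x) (hB : 0 ≤ B)
    (he : 0 ≤ e) (hEB : ∀ t ∈ Set.Icc 2 y, |E t| ≤ B * t) (hEe : ∀ t ∈ Set.Icc y x, |E t| ≤ e * t)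
    (hint : IntegrableOn (fun t ↦ E t / (t * Real.log t ^ 2)) (Set.Icc 2 x) volume) :
    |E x / Real.log x + ∫ t in (2 : ℝ)..x, E t / (t * Real.log t ^ 2)| ≤
      e * (offsetLogIntegral x + 3) + 3 * B * y := by
  have hx2 : 2 ≤ x := hy.trans hyx
  have hlogx : 0 < Real.log x := Real.log_pos (by linarith)
  obtain ⟨hl2, hl22⟩ := log_two_consts
  have hl2pos : 0 < Real.log 2 := Real.log_pos (by norm_num)
  have hF : ∀ {a b : ℝ}, 2 ≤ a → a ≤ b → b ≤ x →
      IntervalIntegrable (fun t ↦ E t / (t * Real.log t ^ 2)) volume a b := by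
    intro a b ha hab hb
    rw [intervalIntegrable_iff_integrableOn_Icc_of_le hab]
    exact hint.mono_set (Set.Icc_subset_Icc ha hb)
  -- pointwise bounds
  have hpt1 : ∀ t ∈ Set.Icc 2 y, |E t / (t * Real.log t ^ 2)| ≤ 3 * B := by
    intro t ht
    have ht2 : 2 ≤ t := ht.1
    have hlogt : Real.log 2 ≤ Real.log t := Real.log_le_log (by norm_num) ht2
    have hlt0 : 0 < Real.log t := by linarith
    have hden : 0 < t * Real.log t ^ 2 := by positivity
    rw [abs_div, abs_of_pos hden, div_le_iff₀ hden]
    have h2 := hEB t ht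
    have h3 : B * t ≤ 3 * B * (t * Real.log t ^ 2) := by
      have : 1 ≤ 3 * Real.log t ^ 2 := by
        have h22 : Real.log 2 ^ 2 ≤ Real.log t ^ 2 := pow_le_pow_left₀ hl2pos.le hlogt 2
        have : 1 ≤ 3 * Real.log 2 ^ 2 := by
          rw [div_le_iff₀ (by positivity)] at hl22; linarith
        linarith
      have ht0 : 0 ≤ B * t := by positivity
      nlinarith
    linarith
  have hpt2 : ∀ t ∈ Set.Icc y x, |E t / (t * Real.log t ^ 2)| ≤ e * (1 / Real.log t ^ 2) := by
    intro t ht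
    have ht2 : 2 ≤ t := hy.trans ht.1
    have hlt0 : 0 < Real.log t := Real.log_pos (by linarith)
    have ht0 : 0 < t := by linarith
    have h := hEe t ht
    rw [abs_div, abs_of_pos (by positivity : 0 < t * Real.log t ^ 2)]
    calc |E t| / (t * Real.log t ^ 2) ≤ (e * t) / (t * Real.log t ^ 2) :=
          div_le_div_of_nonneg_right h (by positivity)
      _ = e * (1 / Real.log t ^ 2) := by field_simp
  -- the two integrals
  have hI1 : |∫ t in (2:ℝ)..y, E t / (t * Real.log t ^ 2)| ≤ 3 * B * y := by
    calc |∫ t in (2:ℝ)..y, E t / (t * Real.log t ^ 2)| ≤ ∫ t in (2:ℝ)..y, |E t / (t * Real.log t ^ 2)| :=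
          intervalIntegral.abs_integral_le_integral_abs hy
      _ ≤ ∫ _ in (2:ℝ)..y, 3 * B := by
          refine intervalIntegral.integral_mono_on hy (hF le_rfl hy hyx).abs (by simp) fun t ht ↦ hpt1 t ht
      _ = (y - 2) * (3 * B) := by rw [intervalIntegral.integral_const, smul_eq_mul]
      _ ≤ 3 * B * y := by nlinarith
  have hone : ∀ {a b : ℝ}, 2 ≤ a → 2 ≤ b → IntervalIntegrable (fun t ↦ 1 / Real.log t ^ 2) volume a b :=
    fun ha hb ↦ Chebyshev.intervalIntegrable_one_div_log_sq (by linarith) (by linarith)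
  have hI2 : |∫ t in y..x, E t / (t * Real.log t ^ 2)| ≤
      e * (offsetLogIntegral x - x / Real.log x + 2 / Real.log 2) := by
    have hLi : ∫ t in (2:ℝ)..x, 1 / Real.log t ^ 2 = offsetLogIntegral x - x / Real.log x + 2 / Real.log 2 := by
      have := offsetLogIntegral_eq_div_log_add_integral hx2; linarith
    have hsplit := intervalIntegral.integral_add_adjacent_intervals (hone le_rfl hy) (hone hy hx2)
    have hnn : 0 ≤ ∫ t in (2:ℝ)..y, 1 / Real.log t ^ 2 :=
      intervalIntegral.integral_nonneg hy fun t _ ↦ by positivity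
    calc |∫ t in y..x, E t / (t * Real.log t ^ 2)| ≤ ∫ t in y..x, |E t / (t * Real.log t ^ 2)| :=
          intervalIntegral.abs_integral_le_integral_abs hyx
      _ ≤ ∫ t in y..x, e * (1 / Real.log t ^ 2) :=
          intervalIntegral.integral_mono_on hyx (hF hy hyx le_rfl).abs ((hone hy hx2).const_mul e)
            fun t ht ↦ hpt2 t ht
      _ = e * ∫ t in y..x, 1 / Real.log t ^ 2 := intervalIntegral.integral_const_mul _ _
      _ ≤ e * ∫ t in (2:ℝ)..x, 1 / Real.log t ^ 2 :=
          mul_le_mul_of_nonneg_left (by linarith) he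
      _ = _ := by rw [hLi]
  have hsplitF := intervalIntegral.integral_add_adjacent_intervals (hF le_rfl hy hyx) (hF hy hyx le_rfl)
  -- the boundary term
  have hbd : |E x / Real.log x| ≤ e * (x / Real.log x) := by
    have h := hEe x ⟨hyx, le_rfl⟩
    rw [abs_div, abs_of_pos hlogx]
    calc |E x| / Real.log x ≤ (e * x) / Real.log x := div_le_div_of_nonneg_right h hlogx.le
      _ = e * (x / Real.log x) := by ring
  rw [← hsplitF, ← add_assoc]
  have hη3 : e * (2 / Real.log 2) ≤ 3 * e := by nlinarith
  have htri := abs_add_three (E x / Real.log x) (∫ t in (2:ℝ)..y, E t / (t * Real.log t ^ 2))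
    (∫ t in y..x, E t / (t * Real.log t ^ 2))
  nlinarith [hbd, hI1, hI2, hη3, htri]

/-! ### The main part of the transfer -/

/-- **Exact transfer of the main term** (`abs_sub_exceptionalLiMain_le` with `A = 0`): for `|θ₁| ≤ 1`,
`1/2 < β ≤ 1`, `h > 0`, `8 ≤ y`, `x ≥ max(256, y²)` and `T₀ = 𝟙_{[y, ∞)} · g/h`, `g(t) = t − θ₁ t^β/β`:
`|T₀(x)/log x + ∫₂ˣ T₀(t) dt/(t log² t) − (Li(x) − θ₁ Li(x^β))/h| ≤ (28/h) √x`. -/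
theorem abs_transfer_main_le {h θ₁ β y x : ℝ} (hh : 0 < h) (hθ : |θ₁| ≤ 1) (hβ : 1 / 2 < β) (hβ1 : β ≤ 1)
    (hy : 8 ≤ y) (hx : 256 ≤ x) (hxy : y ^ 2 ≤ x) :
    |(Set.Ici y).indicator (fun t ↦ (t - θ₁ * t ^ β / β) / h) x / Real.log x +
        (∫ t in (2 : ℝ)..x, (Set.Ici y).indicator (fun t ↦ (t - θ₁ * t ^ β / β) / h) t / (t * Real.log t ^ 2)) -
        (offsetLogIntegral x - θ₁ * offsetLogIntegral (x ^ β)) / h| ≤ 28 / h * Real.sqrt x := by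
  set T₀ : ℝ → ℝ := (Set.Ici y).indicator (fun t ↦ (t - θ₁ * t ^ β / β) / h) with hT₀
  have hy2 : (2 : ℝ) ≤ y := by linarith
  have hx2 : (2 : ℝ) ≤ x := by linarith
  have hT0 : ∀ t, 2 ≤ t → 0 ≤ T₀ t := by
    intro t _
    rw [hT₀, Set.indicator_apply]
    split_ifs with ht
    · exact div_nonneg (exceptionalMainTerm_nonneg hθ hβ hβ1 (le_trans hy ht)) hh.le
    · exact le_rfl
  have hTB : ∀ t, 2 ≤ t → T₀ t ≤ 3 / h * t := by
    intro t ht2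
    rw [hT₀, Set.indicator_apply]
    split_ifs with ht
    · have := abs_exceptionalMainTerm_le hθ hβ hβ1 (by linarith : (1:ℝ) ≤ t)
      rw [div_mul_eq_mul_div, le_div_iff₀ hh, div_mul_cancel₀ _ hh.ne']
      exact (le_abs_self _).trans this
    · positivity
  have hTE : ∀ t, y ≤ t → |T₀ t - (t - θ₁ * t ^ β / β) / h| ≤ 0 * (0 : ℝ) * ((t - θ₁ * t ^ β / β) / h) := by
    intro t ht
    rw [hT₀, Set.indicator_of_mem (show t ∈ Set.Ici y from ht), sub_self, abs_zero]; simp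
  -- integrability: indicator of a function continuous on `[2, x]`
  have hG : ContinuousOn (fun u : ℝ ↦ (u - θ₁ * u ^ β / β) / h / (u * Real.log u ^ 2)) (Set.Icc 2 x) :=
    fun u hu ↦ (continuousAt_exceptionalMainTerm_div θ₁ β h (by linarith [hu.1])).continuousWithinAt
  have hGint := (hG.integrableOn_Icc (μ := volume)).indicator (measurableSet_Ici (a := y))
  have hfun : (fun t ↦ T₀ t / (t * Real.log t ^ 2)) =
      (Set.Ici y).indicator (fun u : ℝ ↦ (u - θ₁ * u ^ β / β) / h / (u * Real.log u ^ 2)) := by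
    funext t
    rw [hT₀, Set.indicator_apply, Set.indicator_apply]
    split_ifs <;> simp
  have hTint : IntervalIntegrable (fun t ↦ T₀ t / (t * Real.log t ^ 2)) volume 2 x := by
    rw [intervalIntegrable_iff_integrableOn_Icc_of_le hx2, hfun]; exact hGint
  have key := abs_sub_exceptionalLiMain_le (T := T₀) (E := fun _ ↦ (0 : ℝ)) (A := 0) (B := 3 / h)
    hh hθ hβ hβ1 le_rfl (by positivity) hy2 hT0 hTB (fun _ _ _ _ _ ↦ le_rfl) (fun _ _ ↦ le_rfl)
    hTE hx hxy hTint rfl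
  refine key.trans (le_of_eq ?_)
  field_simp
  ring

/-! ### The location of the exceptional zero -/

/-- The exceptional zero lies in `(1 − 1/(8 log Q), 1)`: `c/(log|d_K| + log 4) ≤ 1/(8 log Q)` for
`c ≤ 1/(8(n² + 1))`, `Q = |d_K| n^n`, `n = [K:ℚ] > 1` (`log Q = log|d_K| + n log n ≤ log|d_K| + n²`). -/
theorem excRegion_le_inv_eight_log_condQn (K : Type) [Field K] [NumberField K] (hK : 1 < Module.finrank ℚ K)
    {c : ℝ} (hc : 0 ≤ c) (hcn : c ≤ 1 / (8 * ((Module.finrank ℚ K : ℝ) ^ 2 + 1))) :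
    c / (Real.log ((NumberField.discr K).natAbs : ℝ) + Real.log 4) ≤
      1 / (8 * Real.log (ThornerZaman.condQn K)) := by
  set n : ℕ := Module.finrank ℚ K with hn
  set d : ℝ := ((NumberField.discr K).natAbs : ℝ) with hd
  have hd1 : (1 : ℝ) ≤ d := by
    have h1 : 1 ≤ (NumberField.discr K).natAbs :=
      Nat.one_le_iff_ne_zero.2 (Int.natAbs_ne_zero.2 (NumberField.discr_ne_zero K))
    rw [hd]; exact_mod_cast h1
  have hn1 : (1 : ℝ) ≤ n := by rw [hn]; exact_mod_cast Module.finrank_pos (R := ℚ) (M := K)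
  have hlogd : 0 ≤ Real.log d := Real.log_nonneg hd1
  have hlog4 : 1 < Real.log 4 := by
    have : Real.log 4 = 2 * Real.log 2 := by
      rw [show (4:ℝ) = 2 ^ 2 by norm_num, Real.log_pow]; norm_num
    rw [this]; have := Real.log_two_gt_d9; linarith
  have hQ : ThornerZaman.condQn K = d * (n : ℝ) ^ n := by
    rw [ThornerZaman.condQn, hd, Nat.cast_natAbs, Int.cast_abs]
  have hlogQ : Real.log (ThornerZaman.condQn K) = Real.log d + n * Real.log n := by
    rw [hQ, Real.log_mul (by linarith) (by positivity), Real.log_pow]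
  have hlogn : Real.log n ≤ n := (Real.log_le_sub_one_of_pos (by linarith)).trans (by linarith)
  have hlogn0 : 0 ≤ Real.log n := Real.log_nonneg hn1
  have hlogQpos : 0 < Real.log (ThornerZaman.condQn K) := Real.log_pos (ThornerZaman.one_lt_condQn K hK)
  rw [div_le_div_iff₀ (by linarith) (by positivity), one_mul, hlogQ]
  -- `c · 8 (log d + n log n) ≤ log d + log 4`
  have h8c : 8 * c * ((n : ℝ) ^ 2 + 1) ≤ 1 := by
    have := (le_div_iff₀ (by positivity : (0:ℝ) < 8 * ((n : ℝ) ^ 2 + 1))).1 hcn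
    linarith
  have hnn : (n : ℝ) * Real.log n ≤ (n : ℝ) ^ 2 := by nlinarith
  calc c * (8 * (Real.log d + n * Real.log n)) = 8 * c * (Real.log d + n * Real.log n) := by ring
    _ ≤ 8 * c * (Real.log d + (n : ℝ) ^ 2) := by
        refine mul_le_mul_of_nonneg_left (by linarith) (by positivity)
    _ ≤ 8 * c * ((n : ℝ) ^ 2 + 1) * (Real.log d + 1) := by
        have : Real.log d + (n : ℝ) ^ 2 ≤ ((n : ℝ) ^ 2 + 1) * (Real.log d + 1) := by nlinarith
        have h0 : 0 ≤ 8 * c := by positivity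
        calc 8 * c * (Real.log d + (n : ℝ) ^ 2) ≤ 8 * c * (((n : ℝ) ^ 2 + 1) * (Real.log d + 1)) :=
              mul_le_mul_of_nonneg_left this h0
          _ = _ := by ring
    _ ≤ 1 * (Real.log d + 1) := mul_le_mul_of_nonneg_right h8c (by linarith)
    _ ≤ Real.log d + Real.log 4 := by linarith

/-! ### One class: the two parts together -/

/-- **Per-class transfer with additive error.**  If `|θ_C(t) − g(t)/h| ≤ η t/h` on `[y, x]`
(`g(t) = t − θ₁ t^β/β`, `|θ₁| ≤ 1`, `1/2 < β ≤ 1`, `h = h_K`), `θ_K(t) ≤ B t` on `[2, y]`, `8 ≤ y`,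
`x ≥ max(256, y²)`, then
`|π_C(x) − (Li(x) − θ₁ Li(x^β))/h| ≤ η (Li(x) + 3)/h + 3 (B + 3/h) y + 28 √x/h`. -/
theorem abs_primeIdealClassCount_sub_main_le {K : Type} [Field K] [NumberField K] (C : ClassGroup (𝓞 K))
    {θ₁ β y x η B : ℝ} (hθ : |θ₁| ≤ 1) (hβ : 1 / 2 < β) (hβ1 : β ≤ 1) (hy : 8 ≤ y) (hx : 256 ≤ x)
    (hxy : y ^ 2 ≤ x) (hη : 0 ≤ η) (hB : 0 ≤ B)
    (hθC : ∀ t ∈ Set.Icc y x, |chebyshevThetaIdealClass K C t -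
      (t - θ₁ * t ^ β / β) / NumberField.classNumber K| ≤ η * t / NumberField.classNumber K)
    (hBt : ∀ t ∈ Set.Icc 2 y, chebyshevThetaIdeal K t ≤ B * t) :
    |(primeIdealClassCount K C x : ℝ) -
        (offsetLogIntegral x - θ₁ * offsetLogIntegral (x ^ β)) / NumberField.classNumber K| ≤
      η * (offsetLogIntegral x + 3) / NumberField.classNumber K +
        3 * (B + 3 / NumberField.classNumber K) * y + 28 / NumberField.classNumber K * Real.sqrt x := by
  set h : ℝ := (NumberField.classNumber K : ℝ) with hh
  have hh1 : 1 ≤ h := by rw [hh]; exact_mod_cast one_le_classNumber (K := K)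
  have hh0 : 0 < h := by linarith
  have hy2 : (2 : ℝ) ≤ y := by linarith
  have hyx : y ≤ x := by nlinarith
  have hx2 : (2 : ℝ) ≤ x := by linarith
  set T₀ : ℝ → ℝ := (Set.Ici y).indicator (fun t ↦ (t - θ₁ * t ^ β / β) / h) with hT₀
  set E : ℝ → ℝ := fun t ↦ chebyshevThetaIdealClass K C t - T₀ t with hE
  -- integrability
  have hG : ContinuousOn (fun u : ℝ ↦ (u - θ₁ * u ^ β / β) / h / (u * Real.log u ^ 2)) (Set.Icc 2 x) :=
    fun u hu ↦ (continuousAt_exceptionalMainTerm_div θ₁ β h (by linarith [hu.1])).continuousWithinAt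
  have hGint := (hG.integrableOn_Icc (μ := volume)).indicator (measurableSet_Ici (a := y))
  have hfun : (fun t ↦ T₀ t / (t * Real.log t ^ 2)) =
      (Set.Ici y).indicator (fun u : ℝ ↦ (u - θ₁ * u ^ β / β) / h / (u * Real.log u ^ 2)) := by
    funext t
    rw [hT₀, Set.indicator_apply, Set.indicator_apply]
    split_ifs <;> simp
  have hT₀int : IntegrableOn (fun t ↦ T₀ t / (t * Real.log t ^ 2)) (Set.Icc 2 x) volume := by
    rw [hfun]; exact hGint
  have hθint := integrableOn_chebyshevThetaIdealClass_div K C x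
  have hEint : IntegrableOn (fun t ↦ E t / (t * Real.log t ^ 2)) (Set.Icc 2 x) volume := by
    have := hθint.sub hT₀int
    refine this.congr_fun (fun t _ ↦ ?_) measurableSet_Icc
    simp only [hE, Pi.sub_apply, sub_div]
  -- the decomposition `π_C(x) = P[T₀] + P[E]`
  have hπ := primeIdealClassCount_eq_theta_div_log_add_integral K C hx2
  have hsplit : (primeIdealClassCount K C x : ℝ) =
      (T₀ x / Real.log x + ∫ t in (2 : ℝ)..x, T₀ t / (t * Real.log t ^ 2)) +
      (E x / Real.log x + ∫ t in (2 : ℝ)..x, E t / (t * Real.log t ^ 2)) := by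
    rw [hπ]
    have hi1 : IntervalIntegrable (fun t ↦ T₀ t / (t * Real.log t ^ 2)) volume 2 x := by
      rw [intervalIntegrable_iff_integrableOn_Icc_of_le hx2]; exact hT₀int
    have hi2 : IntervalIntegrable (fun t ↦ E t / (t * Real.log t ^ 2)) volume 2 x := by
      rw [intervalIntegrable_iff_integrableOn_Icc_of_le hx2]; exact hEint
    have hsum : ∫ t in (2 : ℝ)..x, chebyshevThetaIdealClass K C t / (t * Real.log t ^ 2) =
        (∫ t in (2 : ℝ)..x, T₀ t / (t * Real.log t ^ 2)) + ∫ t in (2 : ℝ)..x, E t / (t * Real.log t ^ 2) := by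
      rw [← intervalIntegral.integral_add hi1 hi2]
      refine intervalIntegral.integral_congr fun t _ ↦ ?_
      simp only [hE]; ring
    rw [hsum]; simp only [hE]; ring
  -- the error part
  have hEB : ∀ t ∈ Set.Icc 2 y, |E t| ≤ (B + 3 / h) * t := by
    intro t ht
    have h1 : 0 ≤ chebyshevThetaIdealClass K C t := chebyshevThetaIdealClass_nonneg C t
    have h2 : chebyshevThetaIdealClass K C t ≤ B * t :=
      (chebyshevThetaIdealClass_le_chebyshevThetaIdeal C t).trans (hBt t ht)
    have h3 : |T₀ t| ≤ 3 / h * t := by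
      rw [hT₀, Set.indicator_apply]
      split_ifs
      · rw [abs_div, abs_of_pos hh0, div_mul_eq_mul_div, le_div_iff₀ hh0, div_mul_cancel₀ _ hh0.ne']
        exact abs_exceptionalMainTerm_le hθ hβ hβ1 (by linarith [ht.1])
      · rw [abs_zero]; have : 0 ≤ t := by linarith [ht.1]
        positivity
    simp only [hE]
    have := abs_sub (chebyshevThetaIdealClass K C t) (T₀ t)
    rw [abs_of_nonneg h1] at this
    linarith
  have hEe : ∀ t ∈ Set.Icc y x, |E t| ≤ η / h * t := by
    intro t ht
    simp only [hE]
    rw [hT₀, Set.indicator_of_mem (show t ∈ Set.Ici y from ht.1)]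
    have := hθC t ht
    calc |chebyshevThetaIdealClass K C t - (t - θ₁ * t ^ β / β) / h| ≤ η * t / h := this
      _ = η / h * t := by ring
  have herr := abs_transfer_error_le hy2 hyx (by positivity : 0 ≤ B + 3 / h) (by positivity : 0 ≤ η / h)
    hEB hEe hEint
  -- the main part
  have hmain := abs_transfer_main_le (θ₁ := θ₁) hh0 hθ hβ hβ1 hy hx hxy
  rw [hsplit]
  have e1 : η / h * (offsetLogIntegral x + 3) = η * (offsetLogIntegral x + 3) / h := by ring
  rw [e1] at herr
  calc |(T₀ x / Real.log x + ∫ t in (2 : ℝ)..x, T₀ t / (t * Real.log t ^ 2)) +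
        (E x / Real.log x + ∫ t in (2 : ℝ)..x, E t / (t * Real.log t ^ 2)) -
        (offsetLogIntegral x - θ₁ * offsetLogIntegral (x ^ β)) / h|
      = |((T₀ x / Real.log x + ∫ t in (2 : ℝ)..x, T₀ t / (t * Real.log t ^ 2)) -
          (offsetLogIntegral x - θ₁ * offsetLogIntegral (x ^ β)) / h) +
          (E x / Real.log x + ∫ t in (2 : ℝ)..x, E t / (t * Real.log t ^ 2))| := by ring_nf
    _ ≤ |(T₀ x / Real.log x + ∫ t in (2 : ℝ)..x, T₀ t / (t * Real.log t ^ 2)) -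
          (offsetLogIntegral x - θ₁ * offsetLogIntegral (x ^ β)) / h| +
          |E x / Real.log x + ∫ t in (2 : ℝ)..x, E t / (t * Real.log t ^ 2)| := abs_add_le _ _
    _ ≤ 28 / h * Real.sqrt x + (η * (offsetLogIntegral x + 3) / h + 3 * (B + 3 / h) * y) :=
        add_le_add hmain herr
    _ = _ := by ring

end Summit.QuantumAdvantage.QuantumAdvantage.Theorems.DegreeOnePrimesEscape

end
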